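/-
Copyright: statement-level skeleton of a published paper (lit-balaban cell, Phase-2 proof seat p13, gen 8). No proof
claims beyond what the kernel checks below.
-/
import Literature.MathematicalPhysics.QuantumFieldTheory.Balaban1983to89.B4RandomWalk213
import Literature.Probability.LatticeModels.PolymerGasGeometric
import Literature.MathematicalPhysics.QuantumFieldTheory.BalabanImbrieJaffe1984to88.BIJ88Sect5StatementsPart2

/-!
# `BalabanImbrieJaffe1984to88.BIJ88TraceTerms579` — T. Bałaban, J. Imbrie, A. Jaffe, *Effective action and cluster
properties of the abelian Higgs model*, Commun. Math. Phys. **114** (1988) 257–315 [BalabanImbrieJaffe1988]: Sect. 5.7,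
pp. 289–291 — the TRACE TERMS of the expansion (5.7.4) with the expansions of `C^{(j)}_{Λ₁₀}(u_{k+1})` ((2.45)) and of
`W^{(j)}` ((5.7.7)-block) inserted, *"they then take the form Σ_X W^{(j)′}(X)"*: the expansion over WORDS, the REGROUPING
BY THE HULL `X`, and the SUPPORT facts — a non-zero term forces consecutive supports to meet, its `X` is a connected union of
cubes, and the activity assigned to `X` depends only on the letters inside `X` (file 1/3 of the first inequality of (5.7.9);
2/3 = `BIJ88TraceTermsBound579`, 3/3 = `BIJ88Ineq579First`)

statement-level skeleton of published theorems with citation tags; proofs where landed; nothing here is a claim about the Yang–Mills mass gap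

PDF held: `paper:balaban1988-cmp114-bij-abelian-higgs-effective-action` (journal page = PDF page + 256); pp. 289–291, 294
[PDF 33–35, 38] read as IMAGES (CCITT renders `pages/original-p033-x2.png` … ; copies `HOME/lit-balaban-p13/pages/`).

CITATION HEADER (lean-in-tree rule).  Part of the lit-balaban TYPED SKELETON (HOME `run/shared/lean/pub/lit-balaban/`):
WHAT IS REPRODUCED = row **C2.Eq5.7.7-5.7.9** of `HOME/lit-balaban-r16/ROWS-C2-part2.md`, member *(5.7.9), first
inequality* (typed so far: r16's leaf `BIJ88Sect5StatementsPart2.Ineq579`, first conjunct); unit `lit-balaban-p13` (gen 8),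
owner r16, referee ref-5.  Built BY NAME on r01's `Balaban1983to89.B4RandomWalk213` (`bprod`, `sum_pow_eq_sum_bprod`,
`sum_tuple_succ`) and the tree's `Literature.Probability.LatticeModels.IsRConnected`; nothing restated.

## The print (p. 289 [PDF 33] and p. 291 [PDF 35], verbatim)

(5.7.4): *"Thus the determinant can be expanded as exp[Σ_{l=1}^{∞} (1/2l) tr(C^{(j)}_{Λ₁₀^{(j)}}(u_{k+1})W^{(j)})^l]."*
p. 289: *"The operator C^{(j)}_{Λ₁₀^{(j)}}(u_{k+1}) is our first encounter with nonlocal effects. To treat it we apply the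
generalized random walk expansion (2.45), modified slightly to use cubes of size L^{k−j}r(e_k) in T_{L^{−j}}. We need a
similar expansion for W^{(j)} into terms defined in regions X with appropriate decay estimates."*  p. 291: *"In the
expansion (5.7.4) we put W^{(j)} = W^{(j,n̄)} + Σ_X W^{(j)}(X). In terms with l ≤ n̄ we separate from
(1/2l) tr(C^{(j)}_{Λ₁₀^{(j)}}(u_{k+1})W^{(j,n̄)}) the terms of order ≤ n̄ in e_j. […] These will be treated carefully by a
resummation. In the other terms we insert the expansion for C^{(j)}_{Λ₁₀^{(j)}}(u_{k+1}); they then take the form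
Σ_X W^{(j)′}(X), with  |W^{(j)′}(X)| ≤ e_j^{n̄+1−α} e^{−cr(e_k)|X|^−} (r(e_k)L^{k−j})^d |X| ≤ e_j^κ e^{−cr(e_k)|X|^−}. (5.7.9)
We can take κ arbitrarily large by increasing n̄. The high power of e_j beats the big factor (r(e_k)L^{k−j})^d, the volume of
an elementary cube measured on the j-th scale. This is to account for one free summation on T₁^{(j)}; all but one such
summation is controlled by exponential decay on the j-th scale."*  p. 294: *"As always, X is a connected union of
L^{k−j}r(e_k)-cubes, and W^{(j)(iv)}(X) has dependence only on fields in X, X̄, or B_{k−j}(X)."*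

## The typing (model instance, READING declared; shared by the three files `BIJ88TraceTerms579`,
`BIJ88TraceTermsBound579`, `BIJ88Ineq579First`)

* SITES `T` (the real coordinates of the fields on `Λ₁₀^{(j)} ⊂ T_{L^{−j}}`, as in p02's typing of (5.7.4),
  `BIJ88TraceLog574`), ELEMENTARY CUBES `ι` (*"cubes of size L^{k−j}r(e_k)"*) with the cube map `cube : T → ι`, at most
  `s` sites per cube (print: `s = (r(e_k)L^{k−j})^d`, *"the volume of an elementary cube measured on the j-th scale"*).
* THE TWO EXPANDED OPERATORS as finite families of real kernels with cube supports: `C = Σ_a C_a` (`Cl : A → Matrix T T ℝ`,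
  support `sC a : Finset ι`) — the local pieces and the `C_X` of the random walk expansion (2.45) — and `W = Σ_b W_b`
  (`Wl : B → Matrix T T ℝ`, support `sW b`) — the pieces of `W^{(j,n̄)}` and the `W^{(j)}(X)` of the block (5.7.7); SUPPORT
  means `C_a(x,y) ≠ 0 ⇒ cube x, cube y ∈ sC a` (*"G_j(Ω,X,u;x₁,x₂) = 0 unless both x₁ and x₂ are in X"*, (2.45)/(5.7.8)).
  A WORD of length `l` is `w : Fin l → A × B`; its term in `tr((CW)^l)` is `tr(C_{a₁}W_{b₁}⋯C_{a_l}W_{b_l})` =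
  `(bprod (letter Cl Wl) l w).trace` (r01's ordered product `B4RandomWalk213.bprod`); its HULL is the union of the
  supports of its letters; `wlen l S X` is the sum of the terms of the words of length `l` with hull `X` selected by a
  decidable predicate `S` (*"the other terms"*), and `W^{(j)′}(X) = Σ_{l≥1} (1/2l)·wlen l S X` (`BIJ88Ineq579First.Wprime`).
* NORMS: the `ℓ^∞`-OPERATOR norm of real matrices (max row sum; Mathlib scope `Matrix.Norms.Operator`), as in
  `BIJ88TraceLog574` and `BIJ88Neumann5711`; the decay inputs are ROOTED SUMS over the pieces through a cube (hypotheses).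

## What is kernel-checked here

* `trace_pow_eq_sum_words` — `tr(((Σ_a C_a)(Σ_b W_b))^l) = Σ_{words w of length l} tr(C_{a₁}W_{b₁}⋯C_{a_l}W_{b_l})`;
  `sum_words_eq_sum_hulls` — REGROUPING BY THE HULL: `Σ_{w : S w} tr(word w) = Σ_X wlen l S X`;
  `trace_term_eq_sum_wlen_add` — each term of (5.7.4) is `Σ_X (1/2l)wlen l S X + Σ_X (1/2l)wlen l (¬S) X` (*"the other
  terms"* and the separated low-order ones).
* `linkedFrom_of_mul_bprod_apply_ne_zero` / `linkedFrom_of_bprod_apply_ne_zero` — a non-zero entry of a word forces the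
  chain of supports to be LINKED (consecutive members meet); `cube_mem_hull_of_bprod_apply_ne_zero`.
* `isRConnected_hull`, `isRConnected_hull_of_trace_ne_zero`, **`wlen_ne_zero_connected`** — *"As always, X is a connected
  union of L^{k−j}r(e_k)-cubes"*: `wlen l S X ≠ 0 ⇒ X` is `R`-connected, for letters supported in `R`-connected cube sets.
* **`wlen_congr`** — `wlen l S X` depends only on the letters supported inside `X` (*"dependence only on fields in X"*).

HONEST SCOPE.  The letters, their supports and the selection `S` are INPUTS (nothing of Sects. 2–5 is constructed); the
regrouping is an identity of finite sums, valid for every selection.  Theorems + the definitions (with bodies) `letter`,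
`psupp`, `hull`, `LinkedFrom` (+ its `Decidable` instance), `wlen`, `Wprime` (`W^{(j)′}`), the constant `K579` and the cube
polymer system `cubePolymers` used by files 2/3–3/3; no `Prop` facts; axioms standard.
-/

namespace Literature.MathematicalPhysics.QuantumFieldTheory.BalabanImbrieJaffe1984to88.BIJ88TraceTerms579

open Finset
open Literature.MathematicalPhysics.QuantumFieldTheory.Balaban1983to89.B4RandomWalk213
  (bprod bprod_zero bprod_succ bprod_cons bprod_one sum_pow_eq_sum_bprod sum_tuple_succ)
open Literature.Probability.LatticeModels (IsRConnected)
open scoped Matrix Matrix.Norms.Operator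

variable {T ι A B : Type*} [Fintype T] [DecidableEq T] [Fintype ι] [DecidableEq ι]
  [Fintype A] [DecidableEq A] [Fintype B] [DecidableEq B]

/-! ## §1 Words, letters, hulls, linked chains -/

section Words

/-- The letter of the pair `(a,b)` in `(CW)^l = Σ_{a₁b₁…a_lb_l} C_{a₁}W_{b₁}⋯C_{a_l}W_{b_l}`: `C_a W_b`.
[cite: BalabanImbrieJaffe1988, (5.7.4) p.289] -/
def letter (Cl : A → Matrix T T ℝ) (Wl : B → Matrix T T ℝ) (p : A × B) : Matrix T T ℝ := Cl p.1 * Wl p.2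

/-- The cube support of the pair `(a,b)`: `sC a ∪ sW b`. [cite: BalabanImbrieJaffe1988, (5.7.8) p.291] -/
def psupp (sC : A → Finset ι) (sW : B → Finset ι) (p : A × B) : Finset ι := sC p.1 ∪ sW p.2

/-- The HULL of a word `w = ((a₁,b₁),…,(a_l,b_l))`: the union of the cube supports of its letters — the `X` to which the
term `tr(C_{a₁}W_{b₁}⋯C_{a_l}W_{b_l})` is assigned in *"they then take the form Σ_X W^{(j)′}(X)"*.
[cite: BalabanImbrieJaffe1988, (5.7.9) p.291] -/
def hull (sC : A → Finset ι) (sW : B → Finset ι) : (l : ℕ) → (Fin l → A × B) → Finset ι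
  | 0, _ => ∅
  | l + 1, w => psupp sC sW (w 0) ∪ hull sC sW l (Fin.tail w)

/-- `LinkedFrom Y l w`: the chain of supports `Y, sC a₁, sW b₁, sC a₂, …, sW b_l` has every two consecutive members
meeting — the only words whose term can be non-zero after a kernel whose columns live in `Y`
(`linkedFrom_of_mul_bprod_apply_ne_zero`). [cite: BalabanImbrieJaffe1988, (5.7.9) p.291] -/
def LinkedFrom (sC : A → Finset ι) (sW : B → Finset ι) : Finset ι → (l : ℕ) → (Fin l → A × B) → Prop
  | _, 0, _ => True
  | Y, l + 1, w => (Y ∩ sC (w 0).1).Nonempty ∧ (sC (w 0).1 ∩ sW (w 0).2).Nonempty ∧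
      LinkedFrom sC sW (sW (w 0).2) l (Fin.tail w)

/-- `LinkedFrom` is decidable (structural recursion), so that words can be selected by it.
[cite: BalabanImbrieJaffe1988, (5.7.9) p.291] -/
instance instDecidableLinkedFrom (sC : A → Finset ι) (sW : B → Finset ι) :
    (Y : Finset ι) → (l : ℕ) → (w : Fin l → A × B) → Decidable (LinkedFrom sC sW Y l w)
  | _, 0, _ => isTrue trivial
  | Y, l + 1, w =>
      haveI := instDecidableLinkedFrom sC sW (sW (w 0).2) l (Fin.tail w)
      inferInstanceAs (Decidable ((Y ∩ sC (w 0).1).Nonempty ∧ (sC (w 0).1 ∩ sW (w 0).2).Nonempty ∧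
        LinkedFrom sC sW (sW (w 0).2) l (Fin.tail w)))

variable (sC : A → Finset ι) (sW : B → Finset ι)

omit [Fintype ι] [Fintype A] [DecidableEq A] [Fintype B] [DecidableEq B] in
/-- unfolding of the hull of a word `(p, w)`: the support of the first pair, then the hull of the rest.
[cite: BalabanImbrieJaffe1988, (5.7.9) p.291] -/
@[simp] theorem hull_cons (l : ℕ) (p : A × B) (w : Fin l → A × B) :
    hull sC sW (l + 1) (Fin.cons p w) = psupp sC sW p ∪ hull sC sW l w := by
  simp only [hull, Fin.cons_zero, Fin.tail_cons]

omit [Fintype ι] [Fintype A] [DecidableEq A] [Fintype B] [DecidableEq B] in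
/-- unfolding of `LinkedFrom` on a word `(p, w)`. [cite: BalabanImbrieJaffe1988, (5.7.9) p.291] -/
@[simp] theorem linkedFrom_cons (Y : Finset ι) (l : ℕ) (p : A × B) (w : Fin l → A × B) :
    LinkedFrom sC sW Y (l + 1) (Fin.cons p w) ↔
      (Y ∩ sC p.1).Nonempty ∧ (sC p.1 ∩ sW p.2).Nonempty ∧ LinkedFrom sC sW (sW p.2) l w := by
  simp only [LinkedFrom, Fin.cons_zero, Fin.tail_cons]

omit [Fintype ι] [Fintype A] [DecidableEq A] [Fintype B] [DecidableEq B] in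
/-- a cube lies in the hull of a word iff it lies in the support of one of its letters (the `X` of a term is the union of
the regions of its factors). [cite: BalabanImbrieJaffe1988, (5.7.9) p.291] -/
theorem mem_hull_iff : ∀ (l : ℕ) (w : Fin l → A × B) (c : ι),
    c ∈ hull sC sW l w ↔ ∃ i, c ∈ psupp sC sW (w i)
  | 0, w, c => by simp [hull]
  | l + 1, w, c => by
      rw [hull, Finset.mem_union, mem_hull_iff l (Fin.tail w) c]
      constructor
      · rintro (h | ⟨i, hi⟩)
        · exact ⟨0, h⟩
        · exact ⟨i.succ, hi⟩
      · rintro ⟨i, hi⟩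
        refine Fin.cases ?_ (fun j hj => ?_) i hi
        · exact fun h => Or.inl h
        · exact Or.inr ⟨j, hj⟩

omit [Fintype ι] [Fintype A] [DecidableEq A] [Fintype B] [DecidableEq B] in
/-- the support of every letter lies in the hull. [cite: BalabanImbrieJaffe1988, (5.7.9) p.291] -/
theorem psupp_subset_hull (l : ℕ) (w : Fin l → A × B) (i : Fin l) : psupp sC sW (w i) ⊆ hull sC sW l w :=
  fun c hc => (mem_hull_iff sC sW l w c).2 ⟨i, hc⟩

omit [Fintype ι] [Fintype A] [DecidableEq A] [Fintype B] [DecidableEq B] in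
/-- `|hull w| ≤ Σ_i (|sC a_i| + |sW b_i|)` — the decay `e^{−κ|X|}` of a term assigned to `X` is paid by the decay of its
letters. [cite: BalabanImbrieJaffe1988, (5.7.9) p.291] -/
theorem card_hull_le : ∀ (l : ℕ) (w : Fin l → A × B),
    (hull sC sW l w).card ≤ ∑ i, ((sC (w i).1).card + (sW (w i).2).card)
  | 0, w => by simp [hull]
  | l + 1, w => by
      rw [hull, Fin.sum_univ_succ]
      calc (psupp sC sW (w 0) ∪ hull sC sW l (Fin.tail w)).card
          ≤ (psupp sC sW (w 0)).card + (hull sC sW l (Fin.tail w)).card := Finset.card_union_le _ _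
        _ ≤ ((sC (w 0).1).card + (sW (w 0).2).card) + ∑ i : Fin l, ((sC (w i.succ).1).card + (sW (w i.succ).2).card) :=
            add_le_add (Finset.card_union_le _ _) (card_hull_le l (Fin.tail w))

end Words

/-! ## §2 The expansion of `tr((CW)^l)` over words and its regrouping by the hull -/

section Regroup

variable (cube : T → ι) (Cl : A → Matrix T T ℝ) (sC : A → Finset ι) (Wl : B → Matrix T T ℝ) (sW : B → Finset ι)

omit [DecidableEq T] [DecidableEq A] [DecidableEq B] in
/-- `(Σ_a C_a)(Σ_b W_b) = Σ_{(a,b)} C_aW_b` — both expansions inserted in one factor `CW` of (5.7.4).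
[cite: BalabanImbrieJaffe1988, (5.7.4) p.289, (5.7.9) p.291] -/
theorem mul_sum_eq_sum_letter : (∑ a, Cl a) * (∑ b, Wl b) = ∑ p : A × B, letter Cl Wl p := by
  rw [Finset.sum_mul_sum, Fintype.sum_prod_type]
  rfl

omit [DecidableEq A] [DecidableEq B] in
/-- **`tr((CW)^l)` OVER WORDS**: `tr(((Σ_a C_a)(Σ_b W_b))^l) = Σ_{w : Fin l → A×B} tr(C_{a₁}W_{b₁}⋯C_{a_l}W_{b_l})` — the
`l`-th trace of (5.7.4) with both expansions inserted (multilinearity; r01's `sum_pow_eq_sum_bprod`).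
[cite: BalabanImbrieJaffe1988, (5.7.4) p.289, (5.7.9) p.291] -/
theorem trace_pow_eq_sum_words (l : ℕ) :
    (((∑ a, Cl a) * (∑ b, Wl b)) ^ l).trace = ∑ w : Fin l → A × B, (bprod (letter Cl Wl) l w).trace := by
  rw [mul_sum_eq_sum_letter, sum_pow_eq_sum_bprod, Matrix.trace_sum]

/-- **`wlen l S X`** — the contribution of the words of length `l` with hull `X` selected by `S` (*"the other terms"*):
`Σ_{w : hull w = X, S w} tr(C_{a₁}W_{b₁}⋯C_{a_l}W_{b_l})`.  `W^{(j)′}(X)` of (5.7.9) is `Σ_l (1/2l)·wlen l S X`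
(`Wprime`). [cite: BalabanImbrieJaffe1988, (5.7.9) p.291] -/
def wlen (l : ℕ) (S : (Fin l → A × B) → Prop) [DecidablePred S] (X : Finset ι) : ℝ :=
  ∑ w ∈ Finset.univ.filter (fun w => hull sC sW l w = X ∧ S w), (bprod (letter Cl Wl) l w).trace

/-- **`W^{(j)′}(X)`** — *"they then take the form Σ_X W^{(j)′}(X)"*: the selected trace terms of (5.7.4) assigned to the
cube set `X`, summed over the length with the printed weights `1/2l`:
`W′(X) = Σ_{l≥1} (1/2l) Σ_{w : hull w = X, S w} tr(C_{a₁}W_{b₁}⋯C_{a_l}W_{b_l})` (index `l : ℕ` from `0`, printed `l`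
being `l + 1`, as in `BIJ88TraceLog574.hasSum_eq574`). [cite: BalabanImbrieJaffe1988, (5.7.9) p.291] -/
noncomputable def Wprime (S : (l : ℕ) → (Fin (l + 1) → A × B) → Prop) [∀ l, DecidablePred (S l)] (X : Finset ι) : ℝ :=
  ∑' l : ℕ, 1 / (2 * ((l : ℝ) + 1)) * wlen Cl sC Wl sW (l + 1) (S l) X

/-- The constant of the summed bound: with `θ = N_κ(C)·N_κ(w)` and `ρ = ε·θ < 1`,
`K = Σ_{l=1}^{m} θ^l/(2l) + ρ·θ^m/(2(m+1)(1−ρ))` (so that `Σ_{l≥1} ε^{max(m,l)}θ^l/(2l) ≤ ε^m·K`).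
[cite: BalabanImbrieJaffe1988, (5.7.9) p.291] -/
noncomputable def K579 (θ ρ : ℝ) (m : ℕ) : ℝ :=
  (∑ l ∈ Finset.range m, θ ^ (l + 1) / (2 * ((l : ℝ) + 1))) + ρ * θ ^ m / (2 * ((m : ℝ) + 1) * (1 - ρ))

omit [DecidableEq A] [DecidableEq B] in
/-- **REGROUPING BY THE HULL** — *"they then take the form Σ_X W^{(j)′}(X)"*: the selected words, summed, equal the sum
over all cube sets `X` of the words with hull `X`. [cite: BalabanImbrieJaffe1988, (5.7.9) p.291] -/
theorem sum_words_eq_sum_hulls (l : ℕ) (S : (Fin l → A × B) → Prop) [DecidablePred S] :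
    ∑ w ∈ Finset.univ.filter S, (bprod (letter Cl Wl) l w).trace = ∑ X : Finset ι, wlen Cl sC Wl sW l S X := by
  rw [← Finset.sum_fiberwise (Finset.univ.filter S) (hull sC sW l) (fun w => (bprod (letter Cl Wl) l w).trace)]
  refine Finset.sum_congr rfl fun X _ => ?_
  rw [wlen, Finset.filter_filter]
  exact Finset.sum_congr (Finset.filter_congr fun w _ => and_comm) fun _ _ => rfl

omit [DecidableEq A] [DecidableEq B] in
/-- **THE `l`-TH TERM OF (5.7.4), SPLIT AND LOCALIZED**: `(1/2l)·tr((CW)^l) = Σ_X (1/2l)·wlen l S X + Σ_X (1/2l)·wlen l (¬S) X`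
— the selected words (*"the other terms … Σ_X W^{(j)′}(X)"*) and the unselected ones (*"the terms of order ≤ n̄ in e_j …
treated carefully by a resummation"*), each regrouped by the hull. [cite: BalabanImbrieJaffe1988, (5.7.4) p.289, (5.7.9) p.291] -/
theorem trace_term_eq_sum_wlen_add (l : ℕ) (S : (Fin l → A × B) → Prop) [DecidablePred S] (r : ℝ) :
    r * (((∑ a, Cl a) * (∑ b, Wl b)) ^ l).trace =
      ∑ X : Finset ι, r * wlen Cl sC Wl sW l S X + ∑ X : Finset ι, r * wlen Cl sC Wl sW l (fun w => ¬ S w) X := by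
  rw [trace_pow_eq_sum_words, ← Finset.mul_sum, ← Finset.mul_sum, ← mul_add, ← sum_words_eq_sum_hulls,
    ← sum_words_eq_sum_hulls, Finset.sum_filter_add_sum_filter_not]

end Regroup

/-! ## §3 Support: linked chains, connected hulls, locality -/

section Support

variable {cube : T → ι} {Cl : A → Matrix T T ℝ} {sC : A → Finset ι} {Wl : B → Matrix T T ℝ} {sW : B → Finset ι}

omit [DecidableEq T] [Fintype ι] [DecidableEq ι] [Fintype A] [DecidableEq A] [Fintype B] [DecidableEq B] in
/-- a non-zero entry of a product has a non-zero intermediate pair of entries. [folklore] -/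
private theorem exists_of_mul_apply_ne_zero {M N : Matrix T T ℝ} {x y : T} (h : (M * N) x y ≠ 0) :
    ∃ z, M x z ≠ 0 ∧ N z y ≠ 0 := by
  rw [Matrix.mul_apply] at h
  obtain ⟨z, -, hz⟩ := Finset.exists_ne_zero_of_sum_ne_zero h
  exact ⟨z, (mul_ne_zero_iff.mp hz).1, (mul_ne_zero_iff.mp hz).2⟩

omit [Fintype ι] [Fintype A] [DecidableEq A] [Fintype B] [DecidableEq B] in
/-- **LINKED CHAINS** — if the columns of `M` live in `Y` (`M(x,y) ≠ 0 ⇒ cube y ∈ Y`) and every letter is supported in its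
cube set, then a non-zero entry of `M·C_{a₁}W_{b₁}⋯C_{a_l}W_{b_l}` forces `Y ∩ sC a₁ ≠ ∅`, `sC a₁ ∩ sW b₁ ≠ ∅`,
`sW b₁ ∩ sC a₂ ≠ ∅`, … (the product of two kernels with disjoint supports vanishes).
[cite: BalabanImbrieJaffe1988, (5.7.8)–(5.7.9) p.291] -/
theorem linkedFrom_of_mul_bprod_apply_ne_zero
    (hCs : ∀ a x y, Cl a x y ≠ 0 → cube x ∈ sC a ∧ cube y ∈ sC a)
    (hWs : ∀ b x y, Wl b x y ≠ 0 → cube x ∈ sW b ∧ cube y ∈ sW b) :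
    ∀ (l : ℕ) (w : Fin l → A × B) (M : Matrix T T ℝ) (Y : Finset ι),
      (∀ x y, M x y ≠ 0 → cube y ∈ Y) → ∀ x y, (M * bprod (letter Cl Wl) l w) x y ≠ 0 → LinkedFrom sC sW Y l w
  | 0, _, _, _, _, _, _, _ => trivial
  | l + 1, w, M, Y, hM, x, y, h => by
      rw [bprod_succ, ← mul_assoc] at h
      have hM' : ∀ x y, (M * letter Cl Wl (w 0)) x y ≠ 0 → cube y ∈ sW (w 0).2 := by
        intro x' y' h'
        rw [letter, ← mul_assoc] at h'
        obtain ⟨z, -, hz⟩ := exists_of_mul_apply_ne_zero h'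
        exact (hWs _ _ _ hz).2
      refine ⟨?_, ?_, linkedFrom_of_mul_bprod_apply_ne_zero hCs hWs l (Fin.tail w) _ _ hM' x y h⟩
      all_goals
        obtain ⟨z, hz, -⟩ := exists_of_mul_apply_ne_zero h
        rw [letter, ← mul_assoc] at hz
        obtain ⟨u, hu, huz⟩ := exists_of_mul_apply_ne_zero hz
        obtain ⟨v, hv, hvu⟩ := exists_of_mul_apply_ne_zero hu
      · exact ⟨cube v, Finset.mem_inter.2 ⟨hM _ _ hv, (hCs _ _ _ hvu).1⟩⟩
      · exact ⟨cube u, Finset.mem_inter.2 ⟨(hCs _ _ _ hvu).2, (hWs _ _ _ huz).1⟩⟩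

omit [Fintype ι] [Fintype A] [DecidableEq A] [Fintype B] [DecidableEq B] in
/-- the rooted form: a non-zero entry `(C_{a₁}W_{b₁}⋯C_{a_l}W_{b_l})(x,y)` forces the chain of supports to be linked from
the cube of `x`. [cite: BalabanImbrieJaffe1988, (5.7.9) p.291] -/
theorem linkedFrom_of_bprod_apply_ne_zero
    (hCs : ∀ a x y, Cl a x y ≠ 0 → cube x ∈ sC a ∧ cube y ∈ sC a)
    (hWs : ∀ b x y, Wl b x y ≠ 0 → cube x ∈ sW b ∧ cube y ∈ sW b)
    (l : ℕ) (w : Fin l → A × B) {x y : T} (h : (bprod (letter Cl Wl) l w) x y ≠ 0) :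
    LinkedFrom sC sW {cube x} l w := by
  classical
  -- prefix by the unit kernel concentrated at `(x,x)`, whose columns live in `{cube x}`
  set E : Matrix T T ℝ := Matrix.of fun i j => if i = x ∧ j = x then (1 : ℝ) else 0 with hE
  have hEcol : ∀ i j, E i j ≠ 0 → cube j ∈ ({cube x} : Finset ι) := by
    intro i j hij
    simp only [hE, Matrix.of_apply, ne_eq, ite_eq_right_iff, one_ne_zero, imp_false, not_not] at hij
    rw [hij.2, Finset.mem_singleton]
  have hExy : (E * bprod (letter Cl Wl) l w) x y = (bprod (letter Cl Wl) l w) x y := by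
    rw [Matrix.mul_apply, Finset.sum_eq_single x]
    · simp [hE]
    · intro z _ hz
      have hz0 : E x z = 0 := by simp [hE, hz]
      rw [hz0, zero_mul]
    · intro hx; exact absurd (Finset.mem_univ x) hx
  exact linkedFrom_of_mul_bprod_apply_ne_zero hCs hWs l w E {cube x} hEcol x y (by rwa [hExy])

omit [Fintype ι] [Fintype A] [DecidableEq A] [Fintype B] [DecidableEq B] in
/-- a non-zero DIAGONAL entry `(C_{a₁}W_{b₁}⋯)(x,x)` of a non-empty word puts the cube of `x` in the first support, hence in
the hull. [cite: BalabanImbrieJaffe1988, (5.7.9) p.291] -/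
theorem cube_mem_hull_of_bprod_apply_ne_zero
    (hCs : ∀ a x y, Cl a x y ≠ 0 → cube x ∈ sC a ∧ cube y ∈ sC a)
    (l : ℕ) (w : Fin (l + 1) → A × B) {x y : T} (h : (bprod (letter Cl Wl) (l + 1) w) x y ≠ 0) :
    cube x ∈ hull sC sW (l + 1) w := by
  rw [bprod_succ, letter, mul_assoc] at h
  obtain ⟨z, hz, -⟩ := exists_of_mul_apply_ne_zero h
  exact psupp_subset_hull sC sW (l + 1) w 0 (Finset.mem_union_left _ (hCs _ _ _ hz).1)

/-! ### connectedness of the hull -/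

omit [Fintype ι] in
/-- two `R`-connected cube sets that meet have an `R`-connected union. [folklore] -/
private theorem isRConnected_union {R : ι → ι → Prop} {X Y : Finset ι} (hX : IsRConnected R X) (hY : IsRConnected R Y)
    (hXY : (X ∩ Y).Nonempty) : IsRConnected R (X ∪ Y) := by
  obtain ⟨z, hz⟩ := hXY
  rw [Finset.mem_inter] at hz
  have lift : ∀ {Z : Finset ι}, Z ⊆ X ∪ Y → ∀ {v w : ι},
      Relation.ReflTransGen (fun x y => R x y ∧ x ∈ Z ∧ y ∈ Z) v w →
      Relation.ReflTransGen (fun x y => R x y ∧ x ∈ X ∪ Y ∧ y ∈ X ∪ Y) v w := by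
    intro Z hZ v w h
    induction h with
    | refl => exact Relation.ReflTransGen.refl
    | tail _ hbc ih => exact ih.tail ⟨hbc.1, hZ hbc.2.1, hZ hbc.2.2⟩
  refine ⟨⟨z, Finset.mem_union_left _ hz.1⟩, fun v hv w hw => ?_⟩
  have hvz : Relation.ReflTransGen (fun x y => R x y ∧ x ∈ X ∪ Y ∧ y ∈ X ∪ Y) v z := by
    rcases Finset.mem_union.1 hv with hv | hv
    · exact lift Finset.subset_union_left (hX.2 v hv z hz.1)
    · exact lift Finset.subset_union_right (hY.2 v hv z hz.2)
  have hzw : Relation.ReflTransGen (fun x y => R x y ∧ x ∈ X ∪ Y ∧ y ∈ X ∪ Y) z w := by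
    rcases Finset.mem_union.1 hw with hw | hw
    · exact lift Finset.subset_union_left (hX.2 z hz.1 w hw)
    · exact lift Finset.subset_union_right (hY.2 z hz.2 w hw)
  exact hvz.trans hzw

omit [Fintype ι] [DecidableEq ι] in
/-- a singleton is `R`-connected. [folklore] -/
private theorem isRConnected_singleton {R : ι → ι → Prop} (c : ι) : IsRConnected R ({c} : Finset ι) :=
  ⟨⟨c, Finset.mem_singleton_self c⟩, fun v hv w hw => by
    rw [Finset.mem_singleton] at hv hw
    subst hv; subst hw
    exact Relation.ReflTransGen.refl⟩

omit [Fintype ι] [Fintype A] [DecidableEq A] [Fintype B] [DecidableEq B] in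
/-- **THE HULL OF A LINKED WORD IS CONNECTED** — if every non-empty letter support is `R`-connected (print: the `X` of the
pieces `C_X`, `W(X)` are connected unions of cubes; the local pieces live on a cube and its neighbours), then
`Y ∪ hull w` is `R`-connected for every word linked from an `R`-connected `Y`.
[cite: BalabanImbrieJaffe1988, (5.7.9) p.291, p.294] -/
theorem isRConnected_hull {R : ι → ι → Prop}
    (hCc : ∀ a, (sC a).Nonempty → IsRConnected R (sC a)) (hWc : ∀ b, (sW b).Nonempty → IsRConnected R (sW b)) :
    ∀ (l : ℕ) (w : Fin l → A × B) (Y : Finset ι), IsRConnected R Y → LinkedFrom sC sW Y l w →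
      IsRConnected R (Y ∪ hull sC sW l w)
  | 0, w, Y, hY, _ => by simpa [hull] using hY
  | l + 1, w, Y, hY, ⟨h1, h2, h3⟩ => by
      have hA : IsRConnected R (sC (w 0).1) :=
        hCc _ (let ⟨c, hc⟩ := h1; ⟨c, (Finset.mem_inter.1 hc).2⟩)
      have hB : IsRConnected R (sW (w 0).2) :=
        hWc _ (let ⟨c, hc⟩ := h2; ⟨c, (Finset.mem_inter.1 hc).2⟩)
      have hYA : IsRConnected R (Y ∪ sC (w 0).1) := isRConnected_union hY hA h1
      have hYAB : IsRConnected R ((Y ∪ sC (w 0).1) ∪ sW (w 0).2) :=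
        isRConnected_union hYA hB (let ⟨c, hc⟩ := h2;
          ⟨c, Finset.mem_inter.2 ⟨Finset.mem_union_right _ (Finset.mem_inter.1 hc).1, (Finset.mem_inter.1 hc).2⟩⟩)
      have htail := isRConnected_hull hCc hWc l (Fin.tail w) (sW (w 0).2) hB h3
      have key : IsRConnected R (((Y ∪ sC (w 0).1) ∪ sW (w 0).2) ∪ (sW (w 0).2 ∪ hull sC sW l (Fin.tail w))) :=
        isRConnected_union hYAB htail (let ⟨c, hc⟩ := hB.1;
          ⟨c, Finset.mem_inter.2 ⟨Finset.mem_union_right _ hc, Finset.mem_union_left _ hc⟩⟩)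
      have hset : Y ∪ hull sC sW (l + 1) w =
          ((Y ∪ sC (w 0).1) ∪ sW (w 0).2) ∪ (sW (w 0).2 ∪ hull sC sW l (Fin.tail w)) := by
        ext c
        simp only [hull, psupp, Finset.mem_union]
        tauto
      rwa [hset]

omit [Fintype ι] [Fintype A] [DecidableEq A] [Fintype B] [DecidableEq B] in
/-- **"X IS A CONNECTED UNION OF CUBES"** (p. 294: *"As always, X is a connected union of L^{k−j}r(e_k)-cubes"*): a word
with a non-zero trace term has an `R`-connected hull, as soon as the letters are supported in `R`-connected cube sets.
[cite: BalabanImbrieJaffe1988, (5.7.9) p.291, p.294] -/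
theorem isRConnected_hull_of_trace_ne_zero {R : ι → ι → Prop}
    (hCs : ∀ a x y, Cl a x y ≠ 0 → cube x ∈ sC a ∧ cube y ∈ sC a)
    (hWs : ∀ b x y, Wl b x y ≠ 0 → cube x ∈ sW b ∧ cube y ∈ sW b)
    (hCc : ∀ a, (sC a).Nonempty → IsRConnected R (sC a)) (hWc : ∀ b, (sW b).Nonempty → IsRConnected R (sW b))
    (l : ℕ) (w : Fin (l + 1) → A × B) (h : (bprod (letter Cl Wl) (l + 1) w).trace ≠ 0) :
    IsRConnected R (hull sC sW (l + 1) w) := by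
  obtain ⟨x, -, hx⟩ := Finset.exists_ne_zero_of_sum_ne_zero h
  have hlink := linkedFrom_of_bprod_apply_ne_zero hCs hWs (l + 1) w hx
  have hmem : cube x ∈ hull sC sW (l + 1) w := cube_mem_hull_of_bprod_apply_ne_zero hCs l w hx
  have key := isRConnected_hull hCc hWc (l + 1) w {cube x} (isRConnected_singleton (cube x)) hlink
  rwa [Finset.union_eq_right.2 (Finset.singleton_subset_iff.2 hmem)] at key

omit [Fintype ι] [DecidableEq A] [DecidableEq B] in
/-- **`W^{(j)′}(X) ≠ 0 ⇒ X` connected**: the length-`l` activity `wlen l S X` vanishes unless `X` is an `R`-connected union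
of cubes (so the sum *"Σ_X W^{(j)′}(X)"* runs over connected `X` only). [cite: BalabanImbrieJaffe1988, (5.7.9) p.291, p.294] -/
theorem wlen_ne_zero_connected {R : ι → ι → Prop}
    (hCs : ∀ a x y, Cl a x y ≠ 0 → cube x ∈ sC a ∧ cube y ∈ sC a)
    (hWs : ∀ b x y, Wl b x y ≠ 0 → cube x ∈ sW b ∧ cube y ∈ sW b)
    (hCc : ∀ a, (sC a).Nonempty → IsRConnected R (sC a)) (hWc : ∀ b, (sW b).Nonempty → IsRConnected R (sW b))
    (l : ℕ) (S : (Fin (l + 1) → A × B) → Prop) [DecidablePred S] {X : Finset ι}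
    (h : wlen Cl sC Wl sW (l + 1) S X ≠ 0) : IsRConnected R X := by
  obtain ⟨w, hw, hne⟩ := Finset.exists_ne_zero_of_sum_ne_zero h
  rw [Finset.mem_filter] at hw
  rw [← hw.2.1]
  exact isRConnected_hull_of_trace_ne_zero hCs hWs hCc hWc l w hne

omit [Fintype ι] [Fintype A] [DecidableEq A] [Fintype B] [DecidableEq B] in
/-- two letter families agreeing on the letters supported inside `X` have the same words with hull `X`. [folklore] -/
private theorem bprod_congr_of_hull {Cl' : A → Matrix T T ℝ} {Wl' : B → Matrix T T ℝ} {X : Finset ι}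
    (hC : ∀ a, sC a ⊆ X → Cl a = Cl' a) (hW : ∀ b, sW b ⊆ X → Wl b = Wl' b) :
    ∀ (l : ℕ) (w : Fin l → A × B), hull sC sW l w ⊆ X → bprod (letter Cl Wl) l w = bprod (letter Cl' Wl') l w
  | 0, _, _ => by simp
  | l + 1, w, hw => by
      rw [hull] at hw
      rw [bprod_succ, bprod_succ, bprod_congr_of_hull hC hW l (Fin.tail w) ((Finset.subset_union_right).trans hw),
        letter, letter, hC _ ((Finset.subset_union_left.trans Finset.subset_union_left).trans hw),
        hW _ ((Finset.subset_union_right.trans Finset.subset_union_left).trans hw)]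

omit [Fintype ι] [DecidableEq A] [DecidableEq B] in
/-- **LOCALITY OF `W^{(j)′}(X)`** — `wlen l S X` depends only on the letters supported inside `X`: two letter families
that agree on every `C_a` with `sC a ⊆ X` and every `W_b` with `sW b ⊆ X` give the same `wlen l S X` (print: the
activities assigned to `X` *"have dependence only on fields in X"*, p. 294, and *"The dependence on u is in X only"*,
p. 291). [cite: BalabanImbrieJaffe1988, (5.7.9) p.291, p.294] -/
theorem wlen_congr {Cl' : A → Matrix T T ℝ} {Wl' : B → Matrix T T ℝ} {X : Finset ι}
    (hC : ∀ a, sC a ⊆ X → Cl a = Cl' a) (hW : ∀ b, sW b ⊆ X → Wl b = Wl' b)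
    (l : ℕ) (S : (Fin l → A × B) → Prop) [DecidablePred S] :
    wlen Cl sC Wl sW l S X = wlen Cl' sC Wl' sW l S X := by
  refine Finset.sum_congr rfl fun w hw => ?_
  rw [Finset.mem_filter] at hw
  exact congrArg Matrix.trace (bprod_congr_of_hull hC hW l w (Finset.subset_of_eq hw.2.1))

end Support

/-! ## §3b The polymer bookkeeping of the cube sets (for the printed shape in `BIJ88Ineq579First`) -/

section Polymers

/-- The polymer bookkeeping of r16's `BIJ88Sect5StatementsPart2.PolymerSys` realised by cube sets: polymers = finite sets
of elementary cubes, `|X|` = their number (*"|X| refers to the number of r(e_k)-cubes in X"*, p. 265; here the cubes are the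
`L^{k−j}r(e_k)`-cubes of p. 289). [cite: BalabanImbrieJaffe1988, (5.7.5) p.289, (5.7.9) p.291] -/
def cubePolymers (ι₀ : Type) : BIJ88Sect5StatementsPart2.PolymerSys := ⟨Finset ι₀, Finset.card⟩

end Polymers

end Literature.MathematicalPhysics.QuantumFieldTheory.BalabanImbrieJaffe1984to88.BIJ88TraceTerms579
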